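import Summits.KontsevichZagierPeriods.KontsevichZagierPeriods.Theses.RootDecompQuadraticDescent
import Summits.KontsevichZagierPeriods.KontsevichZagierPeriods.Theorems.RootDecompQuadraticDescentDarkPairsEleven
import Literature.NumberTheory.Transcendental.KZCubeRationalMoves
import Literature.NumberTheory.Transcendental.KZLogCalculusProofs
import Literature.NumberTheory.Transcendental.KZFibreMapMove
import Literature.NumberTheory.Transcendental.KZSemialgebraicComplex
import HarnessLib

/-! # `RootDecompQuadraticDescentPair18ReductionP1` — part 1/7 of the mechanical ≤400-line split of `Pair18Reduction_v5_landing.lean` (sha256 0a10c70876ba8bf2…)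
Source: decomp-kz lens-6 g8 `Pair18Reduction.lean` v5 (HOME/decomp-kz-lens-6/g8/, sha256 9036e907…; critic g3 CLEARED 12:08:58Z/13:14:52Z): census pair #18 reduced to strips — `pair18_iff_strips : KZ.of A18.rep − 2 • KZ.of B18.rep ∈ KZ.relations ↔ [U1] − [U2r] + [SL] − 2•[K12c] + 2•[Kh] ∈ KZ.relations` (namespace …RootDecompQuadraticDescent.Pair18); `#print axioms` pins removed for landing.
Split by census-1 g9 `gen/splitlean.py`: scopes re-opened with their `open`/`variable`/`set_option` context; mathematics and declaration order unchanged. -/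

/-!
# Row #18 REDUCED (not decided): `[□², dxdy/(2 − x + y + x² − y²)] − 2·[□², dxdy/(2 + x + 2y + x² + 2xy)]`
# is in `KZ.relations` iff an explicit triangle-pair / band statement is

decomp-kz · lens 6 «barrier-complement carving» · generation 8 · addendum 8f companion file.
Cell-bus artefact: NO ledger writes.  `lean check`: see `check_g8f.json` next to this file.

Census row #18 (`A18 = 2·B18 = 0.5013989034403…`) is the last weight-2 box row left open by the
atlas ∪ census engines after `GoldenPair10.lean` decided #10.  This file does NOT decide it; it proves,
by rules 1 + 2 of [KontsevichZagier2001, §1.2] only (rational affine data), the two normal forms of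
NODE.md §8f.1 and packages them as an `iff`:

* `a18_split : [A18] − [Δ, 1/(2 + wv)] − [Δ, 1/(2 − wv)] ∈ KZ.relations` (the #10 diagonal dissection of
  the square with `κ = 2`: four affine maps with `|det| = 2` onto `Δ = {0 ≤ w, 0 ≤ v, w + v ≤ 1}`);
* `b18_affine : [B18] − S18h ∈ KZ.relations`, `S18h = [{0 ≤ t ≤ 1, t ≤ Y ≤ t + 2}, 1/(4 + 2(1+t)Y)]`
  (ONE affine map `(x, y) ↦ (x, x + 2y)`, `|det| = 2`; `2 + x + 2y + x² + 2xy = 2 + (1+x)(x+2y)`);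
* `pair18_iff : ([A18] − 2·[B18] ∈ KZ.relations) ↔ ([Δ,1/(2+wv)] + [Δ,1/(2−wv)] − 2·S18h ∈ KZ.relations)`;
* informative doubled forms via the c-trick of `GoldenPair10.lean` (§5, generic in `|c| ≤ 1`):
  `two_a18_G : 2·[A18] − G(½) − G(−½) ∈ KZ.relations`, `G(c) = [□², 1/((1+u)² + c·uσ)]`, and
  `pair18_iff_doubled : (2·([A18] − 2·[B18]) ∈ KZ.relations) ↔ (G(½) + G(−½) − 2·S18 ∈ KZ.relations)`,
  `S18 = [{0 ≤ t ≤ 1, t ≤ Y ≤ t + 2}, 1/(2 + (1+t)Y)]` (`= H(S(½,1))` after `X = (1+t)/2`).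

In the `H(Π) = ∫∫_Π dXdY/(1+XY)` language of NODE.md §8f: `[Δ,1/(2+wv)] + [Δ,1/(2−wv)]` has value
`H(T_B)`, `T_B = conv{(0,−1),(0,1),(½,0)}`, and `2·S18h` has value `H(S(½,1))`,
`S(½,1) = {½ ≤ X ≤ 1, 2X − 1 ≤ Y ≤ 2X + 1}`; their equality is Landen's `χ₂` identity at `(1+√−7)/2`
(NODE.md §8f.2) — the one move this cell has not realised.

Engine §1–§5 and the §8 infrastructure (`minE`/`maxE`, `gband`/`gcut`, `rel_affine`) are verbatim from
`GoldenPair10.lean` of this generation.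
-/

noncomputable section

open MeasureTheory Set MvPolynomial

namespace Summit.KontsevichZagierPeriods.RootDecompQuadraticDescent.Pair18

open Literature.NumberTheory.Transcendental
open Literature.NumberTheory.Transcendental.KZ
open Literature.ModelTheory.ExponentialFields (IsSemialgebraic continuous_aeval_real)
open Summit.KontsevichZagierPeriods.RootDecompQuadraticDescent.DarkPairs (rel_reflect_rep rel_double
  update_one_apply_zero one_div_eq_mul_one_div)

/-! ## §1 Small `Fin` bookkeeping and intervals (verbatim from `ZetaTwoPairs.lean`) -/
/-- Auxiliary step `snoc2_zero` (§1): snoc2 zero. [bookkeeping] -/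
@[simp] private theorem snoc2_zero (x : Fin 1 → ℝ) (t : ℝ) : (Fin.snoc x t : Fin 2 → ℝ) 0 = x 0 := rfl
/-- Auxiliary step `snoc2_one` (§1): snoc2 one. [bookkeeping] -/
@[simp] private theorem snoc2_one (x : Fin 1 → ℝ) (t : ℝ) : (Fin.snoc x t : Fin 2 → ℝ) 1 = t := rfl
/-- Auxiliary step `init2_zero` (§1): init2 zero. [bookkeeping] -/
@[simp] private theorem init2_zero (z : Fin 2 → ℝ) : Fin.init z 0 = z 0 := rfl
/-- Auxiliary step `last_one_eq` (§1): last one eq. [bookkeeping] -/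
private theorem last_one_eq : (Fin.last 1 : Fin 2) = 1 := rfl

/-- A regular rational function gives a KZ-rational representation. [folklore] -/
private theorem isRational_rep {M : ℕ} (T : RFun M) : T.rep.IsRational :=
  ⟨T.num, T.den, T.den_ne, fun _ _ => rfl⟩

/-- The interval `[a, b]` as a subset of `ℝ¹`. -/
def ivl (a b : ℚ) : Set (Fin 1 → ℝ) := {y | (a : ℝ) ≤ y 0 ∧ y 0 ≤ b}

/-- Auxiliary step `mem_ivl` (§1): mem ivl. [bookkeeping] -/
theorem mem_ivl {a b : ℚ} {y : Fin 1 → ℝ} : y ∈ ivl a b ↔ (a : ℝ) ≤ y 0 ∧ y 0 ≤ b := Iff.rfl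

/-- Auxiliary step `I01` (§1): I01. [bookkeeping] -/
theorem I01 {y : Fin 1 → ℝ} (hy : y ∈ ivl 0 1) : y 0 ∈ Icc (0 : ℝ) 1 := by
  simpa [mem_ivl] using hy

/-- Auxiliary step `isSemialgebraic_ivl` (§1): is Semialgebraic ivl. [bookkeeping] -/
theorem isSemialgebraic_ivl (a b : ℚ) : IsSemialgebraic ℚ (ivl a b) := by
  have h1 := Literature.ModelTheory.ExponentialFields.isSemialgebraic_setOf_eval_le (k := ℚ) (R := ℝ)
    (C a : MvPolynomial (Fin 1) ℚ) (X 0)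
  have h2 := Literature.ModelTheory.ExponentialFields.isSemialgebraic_setOf_eval_le (k := ℚ) (R := ℝ)
    (X 0 : MvPolynomial (Fin 1) ℚ) (C b)
  have h := h1.inter h2
  simp only [MvPolynomial.aeval_C, MvPolynomial.aeval_X, eq_ratCast] at h
  have hset : ivl a b = {y : Fin 1 → ℝ | (a : ℝ) ≤ y 0} ∩ {y | y 0 ≤ (b : ℝ)} := by
    ext y; simp [ivl]
  rw [hset]
  exact h

/-! ## §2 Edges, sub-graph domains, bounded band representations (verbatim from `ZetaTwoPairs.lean`) -/

/-- A `ℚ`-semialgebraic continuous NONNEGATIVE edge function `σ = f(t)` over `[0,1]`. -/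
structure Edge where
  f : ℝ → ℝ
  sa : IsSemialgebraicFunOn ℚ (ivl 0 1) (fun y => f (y 0))
  nonneg : ∀ t ∈ Icc (0 : ℝ) 1, 0 ≤ f t
  cont : ContinuousOn f (Icc (0 : ℝ) 1)

/-- Auxiliary step `exists_bound` (§2): exists bound. [bookkeeping] -/
theorem Edge.exists_bound (E : Edge) : ∃ M, ∀ t ∈ Icc (0 : ℝ) 1, E.f t ≤ M := by
  obtain ⟨C, hC⟩ := isCompact_Icc.exists_bound_of_continuousOn E.cont
  exact ⟨C, fun t ht => (le_abs_self _).trans (by simpa using hC t ht)⟩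

/-- An edge given on `[0,1]` by a quotient of polynomials. -/
def mkEdge (f : ℝ → ℝ) (P Q : MvPolynomial (Fin 1) ℚ) (hQ : ∀ y ∈ ivl 0 1, aeval y Q ≠ 0)
    (hPQ : ∀ y ∈ ivl 0 1, aeval y P / aeval y Q = f (y 0)) (h0 : ∀ t ∈ Icc (0 : ℝ) 1, 0 ≤ f t)
    (hc : ContinuousOn f (Icc (0 : ℝ) 1)) : Edge :=
  ⟨f, (isSemialgebraicFunOn_aeval_div_aeval (isSemialgebraic_ivl 0 1) P Q hQ).congr hPQ, h0, hc⟩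

/-- Auxiliary step `mkEdge_f` (§2): mk Edge f. [bookkeeping] -/
@[simp] theorem mkEdge_f (f : ℝ → ℝ) (P Q hQ hPQ h0 hc) : (mkEdge f P Q hQ hPQ h0 hc).f = f := rfl

/-- The sub-graph domain `{(t, σ) : 0 ≤ t ≤ 1, L(t) ≤ σ ≤ U(t)}`. -/
def sbDom (L U : Edge) : Set (Fin 2 → ℝ) :=
  KZlog.band (ivl 0 1) (fun y => L.f (y 0)) (fun y => U.f (y 0))

/-- Auxiliary step `mem_sbDom` (§2): mem sb Dom. [bookkeeping] -/
theorem mem_sbDom {L U : Edge} {z : Fin 2 → ℝ} :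
    z ∈ sbDom L U ↔ ((0 : ℝ) ≤ z 0 ∧ z 0 ≤ 1) ∧ L.f (z 0) ≤ z 1 ∧ z 1 ≤ U.f (z 0) := by
  show (Fin.init z ∈ ivl 0 1 ∧ L.f (Fin.init z 0) ≤ z (Fin.last 1) ∧
    z (Fin.last 1) ≤ U.f (Fin.init z 0)) ↔ _
  rw [mem_ivl]
  simp only [init2_zero, last_one_eq, Rat.cast_zero, Rat.cast_one]

/-- Auxiliary step `isSemialgebraic_sbDom` (§2): is Semialgebraic sb Dom. [bookkeeping] -/
theorem isSemialgebraic_sbDom (L U : Edge) : IsSemialgebraic ℚ (sbDom L U) :=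
  KZlog.isSemialgebraic_band L.sa U.sa

/-- Auxiliary step `sbDom_subset_Icc` (§2): sb Dom subset Icc. [bookkeeping] -/
theorem sbDom_subset_Icc {L U : Edge} {M : ℝ} (hM : ∀ t ∈ Icc (0 : ℝ) 1, U.f t ≤ M) :
    sbDom L U ⊆ Icc ![(0 : ℝ), 0] ![(1 : ℝ), M] := by
  intro z hz
  rcases mem_sbDom.1 hz with ⟨⟨h1, h2⟩, h3, h4⟩
  have h5 : 0 ≤ z 1 := (L.nonneg _ ⟨h1, h2⟩).trans h3
  refine ⟨fun i => ?_, fun i => ?_⟩ <;> fin_cases i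
  · simpa using h1
  · simpa using h5
  · simpa using h2
  · simpa using h4.trans (hM _ ⟨h1, h2⟩)

/-- Auxiliary step `volume_sbDom_lt_top` (§2): volume sb Dom lt top. [bookkeeping] -/
theorem volume_sbDom_lt_top (L U : Edge) : volume (sbDom L U) < ⊤ := by
  obtain ⟨M, hM⟩ := U.exists_bound
  exact (measure_mono (sbDom_subset_Icc (L := L) hM)).trans_lt measure_Icc_lt_top

/-- The edges `0`, `1`, `t`. -/
def zeroE : Edge := mkEdge (fun _ => 0) 0 1 (fun y _ => by simp) (fun y _ => by simp)
  (fun _ _ => le_rfl) continuousOn_const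
/-- Auxiliary definition `oneE` (§2): one E. [bookkeeping] -/
def oneE : Edge := mkEdge (fun _ => 1) 1 1 (fun y _ => by simp) (fun y _ => by simp)
  (fun _ _ => zero_le_one) continuousOn_const
/-- Auxiliary definition `idE` (§2): id E. [bookkeeping] -/
def idE : Edge := mkEdge (fun t => t) (X 0) 1 (fun y _ => by simp) (fun y _ => by simp)
  (fun _ ht => ht.1) continuousOn_id

/-- Auxiliary step `zeroE_f` (§2): zero E f. [bookkeeping] -/
@[simp] theorem zeroE_f (t : ℝ) : zeroE.f t = 0 := rfl
/-- Auxiliary step `oneE_f` (§2): one E f. [bookkeeping] -/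
@[simp] theorem oneE_f (t : ℝ) : oneE.f t = 1 := rfl
/-- Auxiliary step `idE_f` (§2): id E f. [bookkeeping] -/
@[simp] theorem idE_f (t : ℝ) : idE.f t = t := rfl

/-- Auxiliary step `abs_div_le_of` (§2): abs div le of. [bookkeeping] -/
private theorem abs_div_le_of {N D B : ℝ} (hN : |N| ≤ B) (hD : 1 ≤ D) : |N / D| ≤ B := by
  rw [abs_div, abs_of_pos (lt_of_lt_of_le one_pos hD)]
  exact (div_le_self (abs_nonneg N) hD).trans hN

/-- A band representation on `sbDom L U` with a given bounded continuous semialgebraic integrand. -/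
def BR (L U : Edge) (f : (Fin 2 → ℝ) → ℝ) (hf : IsSemialgebraicFunOn ℚ (sbDom L U) f)
    (hfc : ContinuousOn f (sbDom L U)) (B : ℝ) (hB : ∀ z ∈ sbDom L U, |f z| ≤ B) :
    KZ.IntegralRep 2 where
  domain := sbDom L U
  integrand := f
  isSemialgebraic_domain := isSemialgebraic_sbDom L U
  isSemialgebraicFunOn_integrand := hf
  integrableOn := by
    have hD := isSemialgebraic_sbDom L U
    refine IntegrableOn.of_bound (volume_sbDom_lt_top L U)
      (hfc.aestronglyMeasurable (IsSemialgebraic.measurableSet_holds hD)) B ?_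
    exact (ae_restrict_iff' (IsSemialgebraic.measurableSet_holds hD)).2 (ae_of_all _ fun z hz => by
      rw [Real.norm_eq_abs]; exact hB z hz)

/-- Auxiliary step `BR_domain` (§2): BR domain. [bookkeeping] -/
@[simp] theorem BR_domain (L U : Edge) (f hf hfc B hB) : (BR L U f hf hfc B hB).domain = sbDom L U := rfl
/-- Auxiliary step `BR_integrand` (§2): BR integrand. [bookkeeping] -/
@[simp] theorem BR_integrand (L U : Edge) (f hf hfc B hB) : (BR L U f hf hfc B hB).integrand = f := rfl

/-- The edge `1 + g`. -/
def Edge.onePlus (g : Edge) : Edge :=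
  ⟨fun t => 1 + g.f t,
    (IsSemialgebraicFunOn.add_holds (isSemialgebraicFunOn_ratCast (isSemialgebraic_ivl 0 1) 1) g.sa).congr
      fun y _ => by simp,
    fun t ht => by linarith [g.nonneg t ht], continuousOn_const.add g.cont⟩

/-- Auxiliary step `onePlus_f` (§2): one Plus f. [bookkeeping] -/
@[simp] theorem Edge.onePlus_f (g : Edge) (t : ℝ) : g.onePlus.f t = 1 + g.f t := rfl

/-- Auxiliary step `z0_mem` (§2): z0 mem. [bookkeeping] -/
theorem z0_mem {L U : Edge} {z : Fin 2 → ℝ} (hz : z ∈ sbDom L U) : z 0 ∈ Icc (0 : ℝ) 1 :=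
  (mem_sbDom.1 hz).1

/-- `RA = [ {0 ≤ t ≤ 1, 0 ≤ τ ≤ gp(t)}, c·tʲ dτ dt/(1 + tʲ⁺¹ τ) ]` (after the fibre scaling). -/

theorem cube_eq_band : cube 2 = KZlog.band (ivl 0 1) (fun _ => (0 : ℝ)) fun _ => 1 := by
  ext z
  rw [KZlog.mem_band, last_one_eq, mem_ivl, mem_cube, Fin.forall_fin_two]
  simp only [init2_zero, Rat.cast_zero, Rat.cast_one]

/-- Auxiliary step `cube_eq_sbDom` (§2): cube eq sb Dom. [bookkeeping] -/
theorem cube_eq_sbDom : cube 2 = sbDom zeroE oneE := by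
  rw [cube_eq_band]; rfl

/-- Auxiliary step `rel_trans` (§2): rel trans. [bookkeeping] -/
private theorem rel_trans {a b c : KZ.FormalRep} (h₁ : a - b ∈ KZ.relations) (h₂ : b - c ∈ KZ.relations) :
    a - c ∈ KZ.relations := by
  have h := add_mem h₁ h₂
  rwa [sub_add_sub_cancel] at h

/-- Auxiliary step `rel_symm` (§2): rel symm. [bookkeeping] -/
private theorem rel_symm {a b : KZ.FormalRep} (h : a - b ∈ KZ.relations) : b - a ∈ KZ.relations := by
  have h' := neg_mem h
  rwa [neg_sub] at h'

/-! ## §3 Generic moves: fibre translation, base substitution, vertical pieces (from `SerretPair33.lean`) -/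

/-- Generic fibre translation `s = 1 + σ` (verbatim from `ZetaTwoPairs.lean`). -/
theorem rel_shift (g : Edge) (R R' : KZ.IntegralRep 2) (hR : R.domain = sbDom zeroE g)
    (hR' : R'.domain = sbDom oneE g.onePlus)
    (hint : ∀ z ∈ sbDom zeroE g, R.integrand z = R'.integrand (Fin.snoc (Fin.init z) (1 + z 1))) :
    KZ.of R - KZ.of R' ∈ KZ.relations := by
  have hB : IsSemialgebraic ℚ R.domain := R.isSemialgebraic_domain
  refine of_sub_of_mem_relations_of_fibreMap (G := ivl 0 1) (a := fun y => zeroE.f (y 0))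
    (b := fun y => g.f (y 0)) (a' := fun y => oneE.f (y 0)) (b' := fun y => g.onePlus.f (y 0))
    (fun z => 1 + z 1) (fun _ => (1 : ℝ)) R R' hR hR' (fun y hy => ?_) ?_ ?_ ?_ ?_ ?_ ?_ ?_
  · simpa using g.nonneg _ (I01 hy)
  · have h1 : IsSemialgebraicFunOn ℚ R.domain (fun z : Fin 2 → ℝ => z 1) := by
      simpa using isSemialgebraicFunOn_aeval hB (X 1 : MvPolynomial (Fin 2) ℚ)
    have hone : IsSemialgebraicFunOn ℚ R.domain (fun _ : Fin 2 → ℝ => (1 : ℝ)) := by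
      simpa using isSemialgebraicFunOn_ratCast hB 1
    exact (IsSemialgebraicFunOn.add_holds hone h1).congr fun z _ => by simp only [Pi.add_apply]
  · intro z _; fun_prop
  · intro z _
    show HasDerivAt (fun t => 1 + (Fin.snoc (Fin.init z) t : Fin 2 → ℝ) 1) 1 (z 1)
    simp only [snoc2_one]
    exact (hasDerivAt_id' (z 1)).const_add 1
  · intro z _; exact one_pos
  · intro y _
    show 1 + (Fin.snoc y (zeroE.f (y 0)) : Fin 2 → ℝ) 1 = oneE.f (y 0)
    simp
  · intro y _
    show 1 + (Fin.snoc y (g.f (y 0)) : Fin 2 → ℝ) 1 = g.onePlus.f (y 0)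
    simp
  · intro z hz
    rw [hint z (by rw [← hR]; exact hz), mul_one]

/-- Injectivity and image of an interval under a map with positive derivative in the interior. -/
private theorem injOn_image_of_deriv_pos' {κ κd : ℝ → ℝ} {a b : ℝ} (hab : a ≤ b)
    (hκd : ∀ t ∈ Icc a b, HasDerivAt κ (κd t) t) (hpos : ∀ t ∈ Ioo a b, 0 < κd t) :
    InjOn κ (Icc a b) ∧ κ '' Icc a b = Icc (κ a) (κ b) := by
  have hc : ContinuousOn κ (Icc a b) := fun t ht => (hκd t ht).continuousAt.continuousWithinAt
  have hm : StrictMonoOn κ (Icc a b) := strictMonoOn_of_deriv_pos (convex_Icc a b) hc fun t ht => by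
    rw [interior_Icc] at ht
    rw [(hκd t (Ioo_subset_Icc_self ht)).deriv]
    exact hpos t ht
  refine ⟨hm.injOn, Subset.antisymm ?_ (intermediate_value_Icc hab hc)⟩
  rintro _ ⟨t, ht, rfl⟩
  exact ⟨hm.monotoneOn (left_mem_Icc.2 hab) ht ht.1, hm.monotoneOn ht (right_mem_Icc.2 hab) ht.2⟩

/-- … and with negative derivative in the interior (orientation reversed). -/
theorem injOn_image_of_deriv_neg' {κ κd : ℝ → ℝ} {a b : ℝ} (hab : a ≤ b)
    (hκd : ∀ t ∈ Icc a b, HasDerivAt κ (κd t) t) (hneg : ∀ t ∈ Ioo a b, κd t < 0) :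
    InjOn κ (Icc a b) ∧ κ '' Icc a b = Icc (κ b) (κ a) := by
  have hc : ContinuousOn κ (Icc a b) := fun t ht => (hκd t ht).continuousAt.continuousWithinAt
  have hm : StrictAntiOn κ (Icc a b) := strictAntiOn_of_deriv_neg (convex_Icc a b) hc fun t ht => by
    rw [interior_Icc] at ht
    rw [(hκd t (Ioo_subset_Icc_self ht)).deriv]
    exact hneg t ht
  refine ⟨hm.injOn, Subset.antisymm ?_ (intermediate_value_Icc' hab hc)⟩
  rintro _ ⟨t, ht, rfl⟩
  exact ⟨hm.antitoneOn ht (right_mem_Icc.2 hab) ht.2, hm.antitoneOn (left_mem_Icc.2 hab) ht ht.1⟩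

end Summit.KontsevichZagierPeriods.RootDecompQuadraticDescent.Pair18
end
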